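import Mathlib
import HarnessLib
import HarnessLib.Audit
import Summits.AtomisticToContinuum.Statement
import Summits.AtomisticToContinuum.HydrodynamicLimit.Theorems.ImplosionDichotomyHsEosLowDensity
import HarnessLib.Audit.Status.Attr

/-!
Route: BoxDissipativeWeakStrong

# Route BoxDissipativeWeakStrong — hard-sphere box fields as a zero-defect random dissipative
solution — Březina–Feireisl weak–strong uniqueness in expectation closes Euler from momentum-flux
closure plus a clamped local second law

It suffices to show X = FluxClosure ∧ EntropyAdmissibility ∧ RelativeEnergyStability ∧
LocalGibbsFineScale (card
dissipative-box-closure-bf18, spine; conforming D-0027 successor of the retired route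
DissipativeWeakStrong, every item now typed over the
existing prelude — no Young measures, defects or collision currents). Read the deterministic
(N+1)-sphere flow through the BOX AVERAGES
Û_N = (ρ̂, m̂, Ê)(t,x) of the empirical conserved fields (indicator cubes of side ℓ_N, any kinetic
window ℓ_N → 0, (N+1)ℓ_N³ → ∞) under the
local Gibbs law P_N: the law of Û_N is a dissipative measure-valued solution of the packing-guarded
hard-sphere Euler system in the sense of
Březina–Feireisl (BF18 Def. 2.9) with dissipation defect ≡ 0 and o(1) consistency errors, provided
(K1 FluxClosure) the box momentum flux
closes on m̂⊗m̂/ρ̂ + p_cut𝟙 in L¹(P_N) and (K2 EntropyAdmissibility) the clamp-renormalised local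
entropy inequality holds in expectation; then
(K3 RelativeEnergyStability) BF18's relative-energy Gronwall run on e_N(τ) = E_P ∫E(Û_N | ρ,θ,u)dx,
started from the fine-scale initial
LLN (K0 LocalGibbsFineScale), turns K1 ∧ K2 ∧ K0 into the packing-guarded conjunct on every band η₁
< η_c (typed as that implication).
Since the statement re-type of 2026-08-16 (p126922) the sub-problem decl `HydrodynamicLimit` IS the
packing-guarded limit (threshold
∃ η₀ > 0 outermost, guard ρ_t(x)σ³ < η₀ a hypothesis), so no density-range input is needed any more:
`closes` takes η₀ := η_c/4
(the shared item DiluteSelfConsistency, which removed the band for the old unguarded abbrev, left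
the route's argument in the 2026-08-16 repair).
Lean: `FluxClosure ∧ EntropyAdmissibility ∧ RelativeEnergyStability ∧ LocalGibbsFineScale`

## Assembly
Pure quantifier bookkeeping, PROVED sorry-free as `theorem closes` (2026-08-16 repair, statement
re-type p126922; Sketch2.lean rc 0, axioms propext / Classical.choice /
Quot.sound; #h21_check_closes ok, conclusion = HydrodynamicLimit, hypotheses = FluxClosure,
EntropyAdmissibility,
RelativeEnergyStability, LocalGibbsFineScale, HsEosLowDensity, extra none): RelativeEnergyStability
applied to FluxClosure,
EntropyAdmissibility, LocalGibbsFineScale and HsEosLowDensity (its antecedents, by decl name) yields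
η_c > 0 and the guarded limit on
every band η₁ < η_c with guard ρσ³ ≤ η₁/2; answer the Statement's outer ∃ η₀ with η₀ := η_c/4 and
take the band η₁ := η_c/2; for given
profiles use the σ₀ of the guarded limit as is; for σ < σ₀, a classical solution on [0,T) satisfying
the Statement's own guard
ρ_t(x)σ³ < η_c/4 (hence ≤ η₁/2), flows Φ and the t = 0 LLN, the guarded limit returns
TendstoHydroFieldsAt at every t < T —
`HydrodynamicLimit` (the re-typed sub-problem decl) unfolded. HsEntropyConvex (proved) is a lemma
for the prover of
RelativeEnergyStability, not a hypothesis of `closes`; LocalGibbsFineScale (support, re-typed with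
`0 < T`, proof landed as
LGFS.localGibbsFineScale_of_pos) and HsEosLowDensity (support, proved) are the two non-crux
hypotheses, both theorem-grade.

Rationale: WHY THIS LINE. Weak(measure-valued)–strong uniqueness for the COMPLETE Euler system
(BrezinaFeireisl2018, Def. 2.9 + Thm 3.3, arXiv:1702.04870;
BrezinaFeireisl2018Revisited Thm 2.5; survey Wiedemann2018 §11.2–11.3) needs only the continuity
equation, the momentum balance, the TOTAL
energy balance and a RENORMALISED local entropy inequality with clamps Z_{a,b} — all LINEAR in the
law of the state — plus pointwise
thermodynamic-stability inequalities; numerical analysis already treats finite-volume schemes, also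
with random data, as such "consistent
approximations" that converge to the strong solution (FeireislLukacovamedvidovaMizerova2018,
arXiv:1803.08401; FeireislEtAl2022MonteCarlo),
and particle systems went through DiPerna's mv uniqueness in the scalar attractive case
(Rezakhanlou1991; KipnisLandim1999 Ch. 8). Imported
area: hyperbolic conservation laws (dissipative mv solutions, relative energy of Dafermos1979 /
FeireislNovotny2012) pointed at the
deterministic hard-sphere gas itself: Young measure := law of the finite-N box state, defect := 0
(kinetic energy and mass are exactly
conserved pathwise), so the microscopic input shrinks to a SECOND-moment closure (K1: isotropy +
virial, trace fixed by Ê) and a one-sided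
entropy statement (K2) — no energy-flux (third-moment) closure, no velocity-tail or density-range
control, the one hard-sphere-specific
danger (pressure of jammed pockets) quarantined by a two-line Gibbs-consistent cut of the EOS above
the band η₁ that the strong solution
(ρσ³ ≤ η₁/2) never sees. Versus the board: AnnealedZeroHorizon closes momentum AND energy fluxes in
mean with a GLOBAL second law;
GermanoSplitLES is quenched with energy flux and range control; EntropyBookkeeping /
StrongClosureWeakBV need strong closure or a limit
weak solution — none runs BF18's dissipative class on box laws; the negatives index
(WarmColdDichotomy 9236/9238, degenerate finite
instances) is not touched since every item here is an N → ∞ limit over kinetic windows.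

RANKED CRUXES. #2 FluxClosure (crux) — (card K1) given the hard-sphere EOS fact there is η_c > 0
such that for every band 0 < η₁ < η_c, all continuous positive profiles, σ < σ₀(profiles), every
classical hs-Euler solution on [0,T) with ρσ³ ≤ η₁/2, every flow family whose local-Gibbs fields
satisfy the t = 0 LLN, and EVERY kinetic window ℓ_N (0 < ℓ_N ≤ 1, ℓ_N → 0, (N+1)ℓ_N³ → ∞): for τ < T
and every smooth vector field w on [0,T)×𝕋³ the pathwise momentum-balance defect of the box fields,
[∫m̂·w]_0^τ − ∫_0^τ∫(m̂·∂_t w + (m̂⊗m̂/ρ̂):∇w + p_cut(ρ̂,θ̂) div w) with θ̂ = ⅔(Ê/ρ̂ − |m̂|²/2ρ̂²)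
and p_cut = ρ̂θ̂Z(min(ρ̂σ³, η₁)), tends to 0 in L¹(P_N). Microscopic content: the traceless box
velocity covariance (kinetic stress − m̂⊗m̂/ρ̂ − ρ̂θ̂𝟙) and (collisional transfer − ρ̂θ̂(Z−1)𝟙)
vanish after space-time averaging against ∇w; boxes above the band are flux-negligible. [deps:
HsEosLowDensity] [difficulty: open-problem] (why it might fail: isotropisation + virialisation of
DETERMINISTIC spheres at fixed density has no proof without a mixing input (Boltzmann-hypothesis
family, flux level); jammed pockets above the band η₁ carry a rattler pressure the cut EOS ignores;
only the mean is needed downstream.) [Spohn1991, BrezinaFeireisl2018, OllaVaradhanYau1993,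
DiPernaMajda1987]
#3 EntropyAdmissibility (crux) — (card K2) same frame as FluxClosure; for τ < T, reals a < b and
every smooth φ ≥ 0 on [0,τ]×𝕋³ the positive part of ∫_0^τ∫(ρ̂Z_{a,b}(ŝ)∂_tφ + Z_{a,b}(ŝ)m̂·∇φ) −
[∫ρ̂Z_{a,b}(ŝ)φ]_0^τ tends to 0 in L¹(P_N), where ŝ = 3/2 log θ̂ − log ρ̂ − F_cut(ρ̂σ³) is the box
entropy with the Gibbs-consistent cut excess free energy F_cut(η) = f_ex(min η η₁) +
(Z(η₁)−1)log(max η η₁/η₁) and Z_{a,b}(s) = max a (min s b): BF18's renormalised entropy inequality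
(Def. 2.9, Z ∈ BC(ℝ), Z′ ≥ 0; clamps as in §3.2) for the law of the box state, in expectation, zero
defect. [deps: HsEosLowDensity] [difficulty: open-problem] (why it might fail: no H-theorem
substitute for a deterministic interacting gas; the LOCAL form needs the entropy flux Z(s)m̂ (no
Euler-order heat flux) and, ρs being concave, concentration of box fields at positive times — a
hidden weak local-equilibrium statement.) [BrezinaFeireisl2018, BrezinaFeireisl2018Revisited,
ChenFrid2000, KipnisLandim1999]
#4 RelativeEnergyStability (crux) — (card K3, the PDE theorem in expectation at finite N, stated as
the implication between the route's closure statements and the packing-guarded conjunct) FluxClosure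
→ EntropyAdmissibility → LocalGibbsFineScale → HsEosLowDensity → [∃ η_c > 0 ∀ η₁ < η_c ∀ profiles ∃
σ₀ ∀ σ < σ₀ ∀ classical hs-Euler solutions on [0,T) with ρσ³ ≤ η₁/2 ∀ flow families with the t = 0
LLN: the empirical fields converge in probability to (ρ, ρu, E)(t) at every t < T] (all four
antecedents by decl name since the 2026-08-16 repair; formerly K0 and the EOS fact were inlined
verbatim — defeq, refuter rreview-0815T14-10). Intended proof, per instance and at any one kinetic
window: BF18 Thm 3.3 on e_N(τ) = E_P∫E(Û_N(τ,x) | ρ,θ,u(τ,x))dx with Young measure := law of the box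
state and D ≡ 0 (pathwise continuity equation and energy conservation from the HardSphereFlow
axioms), cut EOS (Gibbs relation, ∂_ρp_cut > 0, c_v = 3/2, |p_cut| ≤ Z(η₁)ρθ so BF18's growth
hypothesis holds), essential/residual coercivity, the φ = 1 minimum principle replaced by a tail
estimate on {ŝ < a} and e_N(0) → 0 by an entropy LLN at kinetic windows provable inside the item
(refuter notes (i)/(ii) on stmt-9904), Gronwall with pointwise-in-τ o(1) errors (dominated
convergence), Markov; box fields → χ-tested fields by uniform continuity of χ; then η_c, σ₀ :=
minima over the inputs. [deps: FluxClosure, EntropyAdmissibility, LocalGibbsFineScale,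
HsEosLowDensity, HsEntropyConvex] [difficulty: L] (why it might fail: BF18's coercivity (WS8) and
minimum principle (§3.2.1, φ = 1) must be redone for the cut EOS with CLAMPED entropy, zero defect
and Lean junk (ρ̂ = 0, log 0 = 0); e_N(0) → 0 needs uniform integrability of box entropy at t = 0,
more than L¹ of the fields.) [BrezinaFeireisl2018, BrezinaFeireisl2018Revisited,
FeireislNovotny2012, Wiedemann2018, Dafermos1979, FeireislLukacovamedvidovaMizerova2018]
#9 LocalGibbsFineScale (support) — (card P1 = K0, statics; re-typed 2026-08-16 with `0 < T →` after
`IsHardSphereEulerSolution σ T ρ u θ →` on the prover's misstatement report — for T ≤ 0 the solution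
predicate is vacuous and ρ 0, u 0, θ 0 are arbitrary, possibly non-measurable, functions pinned only
through junk-valued Bochner integrals; the repaired statement is PROVED and landed,
LGFS.localGibbsFineScale_of_pos, p115466, closing file = one line) for continuous positive profiles,
σ < σ₀, every classical solution on [0,T) with 0 < T whose t = 0 fields are the macroscopic LLN
limit of the local Gibbs laws and every kinetic window: E_P∫(|ρ̂ − ρ(0,·)| + ‖m̂ − ρu(0,·)‖ + |Ê −
E(0,·)|)(x)dx → 0 at t = 0 — low-activity cluster expansion (correlation length ≍ particle scale
(N+1)^(−1/3) ≪ ℓ_N) plus Gaussian velocities; the macroscopic hypothesis identifies the continuous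
limit profiles. [difficulty: M] [Ruelle1969, LebowitzPenrose1964, Spohn1991]
#9 HsEosLowDensity (support) — (shared stmt-AtomisticToContinuum-0768, known in print) the
hard-sphere excess free energy is real-analytic on a neighbourhood of [0,η₀) with F(0) = 0, F′(0) =
2π/3 and the canonical thermodynamic limit exists there (Ruelle1969 Thm 3.4.4, 4.3.2;
LebowitzPenrose1964); antecedent of every crux. [difficulty: L] [Ruelle1969, LebowitzPenrose1964]
(dropped 2026-08-16) DiluteSelfConsistency (shared stmt-AtomisticToContinuum-3091) was load-bearing
for `closes` only to remove the packing band against the old UNGUARDED abbrev; the re-typed conjunct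
carries the band itself (∃ η₀ outermost, guard ρ_t(x)σ³ < η₀), so the item left this route's
argument and then the route in the 2026-08-16 repair; it keeps its other routes. The Assembly item
(formerly stmt-9907 = the rev-1 type of `closes` incl. DiluteSelfConsistency, proved 2026-08-16
against the old abbrev; its proof module no longer compiles after the re-type) was RE-TYPED 1:1 to
the current type of `closes`, FluxClosure → EntropyAdmissibility → RelativeEnergyStability →
LocalGibbsFineScale → HsEosLowDensity → HydrodynamicLimit (provable at once by `closes`; the gate
does not allow dropping an assembly item).
#9 HsEntropyConvex (support) — (ex stmt-AtomisticToContinuum-0817 verbatim; BF18's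
thermodynamic-stability hypothesis (WS1) in conserved variables, lemma for RelativeEnergyStability)
given the EOS fact, ∃ η₀ > 0 ∀ σ > 0: U = (ρ, m, E) ↦ −ρ(3/2 log θ(U) − log ρ − f_ex(ρσ³)) is
strictly convex on the convex set {ρ > 0, ρσ³ < η₀, |m|² < 2ρE} ((ηZ)′ > 0 near 0 + perspective
argument). [difficulty: M] [Dafermos1979, BrezinaFeireisl2018, Ruelle1969]

TWO-LAYER PLAN. Foreseen glued splits (k ≤ 3, depth 1; nothing filed now): FluxClosure ⇐
KineticIsotropy (traceless box velocity covariance → 0 in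
L¹(P⊗dt⊗dx), trace fixed by Ê) → CollisionalVirial (time-integrated collisional momentum transfer −
ρ̂θ̂(Z_cut−1)𝟙 → 0, boxes above η₁
flux-negligible) → FluxClosure, glue = the exact pathwise momentum balance from the trajectory
axioms. EntropyAdmissibility ⇐
PositiveTimeBoxConcentration (box fields concentrate at t > 0 at kinetic windows: the weak
local-equilibrium content flagged by triage) →
MeanLocalEntropyInequality (the annealed inequality, E only) → EntropyAdmissibility.
RelativeEnergyStability ⇐ CutEosStability (Gibbs
relation, (ηZ_cut)′ > 0, growth, coercivity of E_{Z_{a,b}} for the cut EOS — real analysis over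
HsEosLowDensity/HsEntropyConvex) →
BoxBalanceLaws (exact continuity + energy conservation + measurability of t ↦ box functionals on the
good set, law ≪ Liouville) →
RelativeEnergyStability (BF18 Gronwall in expectation). If K1/K2 stall in L¹ form, the ANNEALED
weakening (|E defect| → 0 with
integrability, as in AnnealedZeroHorizon's format) suffices for K3 and is the planned restatement,
not a new route.

KILL CRITERIA. ¬FluxClosure in substance — a smooth pre-shock profile at arbitrarily small σ whose
box momentum flux stays off m̂⊗m̂/ρ̂ + p𝟙 at leading
order in mean — closes the route (`close --reason refuted:FluxClosure`) and is summit-level negative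
evidence; ¬FluxClosure only in the
L¹ (quenched) sense with the mean closing ⇒ restate K1 and K3 annealed (pivot, same route).
¬EntropyAdmissibility by a junk/clamp
artefact (empty or one-particle boxes, 0/0 = 0, log 0 = 0) ⇒ repair by restatement; by a genuine
positive-time coarse-grained entropy
deficit ⇒ close `refuted:EntropyAdmissibility` (the dissipative class is then the wrong currency for
hard spheres). RelativeEnergyStability
is a theorem-track item: a refutation can only expose mis-typing ⇒ restate. The foreseen retreat to
the packing-guarded conjunct happened by
STATEMENT RE-TYPE (2026-08-16, p126922): DiluteSelfConsistency is out of the argument, so no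
density-range (implosion) refutation
bears on `closes` any more; LocalGibbsFineScale / HsEosLowDensity are theorem-grade supports (proof
landed / proved). Any route proving a HydroLimitInBand-strength closure first moots this one
(supersede).

NOT DECOMPOSED YET. The kinetic/collisional split of FluxClosure and the rattler estimate above the
band; the positive-time concentration hidden in
EntropyAdmissibility; for RelativeEnergyStability the cut-EOS stability/coercivity lemmas, the φ = 1
minimum principle with o(1) errors,
measurability/integrability of the time-integrated box functionals (good set of HardSphereFlow,
particleLaw ≪ Liouville), the passage
box fields → χ-tested fields, and the e_N(0) → 0 step; the annealed weakening of K1/K2;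
HsEulerLocalExistence (ex-0818, non-vacuity of
the classical-solution hypothesis) is not re-filed. All are layer-2 children or `--supports` lemmas
once a crux moves.

CHEAPEST FALSIFIER. Evaluate the EntropyAdmissibility and FluxClosure functionals by hand (or a tiny
kit script) on N+1 = 2 spheres sharing one box (θ̂ > 0
a.s.) and on empty / one-particle boxes (ρ̂ = 0 ⇒ m̂ = 0, x/0 = 0; θ̂ = 0 ⇒ log 0 = 0, ŝ = −log ρ̂ −
F_cut): if Lean junk or the clamp made
K2 false or true for trivial reasons the item would need restating — the card author checked empty
and one-particle boxes consistent
by hand, and both statements are N → ∞ limits in which one-particle boxes carry vanishing mass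
((N+1)ℓ_N³ → ∞); in global equilibrium
(constant profiles, invariant Gibbs law) both functionals reduce to CONCENTRATION statements (Var of
∫ρ̂Z(ŝ)φ and CLT-size ∫m̂·w), true.
Physics-level: event-driven MD of ~10⁵ spheres at η = 0.05 with a smooth compression wave, measuring
the traceless box kinetic stress
and (collisional transfer − ρ̂θ̂(Z−1)) at ℓ = 5–20 mean free paths (not run: compute-free hub; a
refuter may `kit compute submit` it).

NUMBERS. Scales (macroscopic units, Spohn1991 I.3): N+1 spheres of diameter σ(N+1)^(−1/3),
interparticle distance ≍ (N+1)^(−1/3), mean free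
path ≍ (N+1)^(−1/3)/(√2πσ²ρ), kinetic windows (N+1)^(−1/3) ≪ ℓ_N ≪ 1, collisions per particle per
unit time ≍ (N+1)^(1/3). EOS:
Z(η) = 1 + (2π/3)η + O(η²) in η = ρσ³ (HsEosLowDensity: F′(0) = 2π/3 = B₂; Ruelle1969 Thm 4.3.2
radius ≥ 0.27846·(4π/3)⁻¹); the band
η₁ < η_c sits inside the analyticity radius, far below freezing. BF18 growth constant for the cut
EOS: |p_cut| ≤ Z(η₁)ρθ = ⅔Z(η₁)ρe.
Items at open: 8 (3 cruxes, 4 supports, 1 assembly); after the 2026-08-16 repair 7 (3 cruxes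
FluxClosure / EntropyAdmissibility / RelativeEnergyStability, 3 supports LocalGibbsFineScale /
HsEosLowDensity / HsEntropyConvex, 1 assembly = the type of `closes`) + the deciding theorem
`closes` (5 hypotheses; η₀ := η_c/4); every signature < 4000 chars (gate cap;
RelativeEnergyStability 3476 → 1268 by naming its antecedents), using the route-file header `open
Filter Set` / `open scoped Topology`.

DEFINITION REQUESTS. None: every item elaborates over Literature.MathematicalPhysics.KineticTheory
(HardSphereEuler.lean), Literature.Analysis.FluidPDE
(HardSphereFlow, Config, Torus.geometry) and Literature.Analysis.FunctionSpaces.Torus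
(IsSmoothSpaceTimeOn, timeDerivWithin,
partialDeriv, divergence, gradient). A later convenience refactor `Kinetic.boxFields` /
`Kinetic.hsCutThermo` would shorten the four
1.9–3.5 k-char statements without changing their meaning (not requested now). Bib added:
BrezinaFeireisl2018Revisited.

Novelty: Searches (2026-08-15): `lit search --hybrid "measure-valued solutions complete Euler system
weak-strong uniqueness particle system hydrodynamic limit hard spheres"` (12 held docs:
fefferman2018 Ch. 11 = Wiedemann2018, kipnis1999 Ch. 8, markfelder2021, dafermos2005,
saint-raymond2009 — none particle-side for systems); `lit search --source zbmath "measure-valued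
solution complete Euler weak-strong uniqueness"` (6: arXiv:1503.05246, arXiv:1702.04870,
arXiv:1803.08401, arXiv:1710.10751, arXiv:1904.00622, arXiv:2112.09955); `lit search --source
crossref "particle system measure-valued solution Euler convergence relative energy" --year-from
2015` (8: doi:10.21136/am.2021.0279-20 Mácha–Wiedemann, doi:10.1016/j.jde.2020.09.028,
doi:10.1007/s00028-025-01150-1 Euler-alignment DMV — nothing on deterministic particles); `lit
galaxy search "measure-valued solutions" --star all` (16 rows: pdf A-free rigidity arXiv:1511.03114,
finite-volume theses; no particle derivations); `lit read arxiv:1702.04870` pp 5–12 and `lit read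
arxiv:1710.10751` pp 4–6 (theorem numbers pinned); `ledger negatives --problem AtomisticToContinuum`
(5); OpenAlex / Semantic Scholar / arXiv API rate-limited today (logged in NOTES.md); board read:
AnnealedZeroHorizon, StrongClosureWeakBV, EntropyBookkeeping, LaxEquivalence, JOddEnslaving,
DissipativeWeakStrong (retired predecessor).
Nearest prior art found: BrezinaFeireisl2018 (arXiv:1702.04870 Def. 2.9, Thm 3.3) and
BrezinaFeireisl2018Revisited (arXiv:1710.10751 Def. 2  [refs: 10.21136/am.2021.0279-20, 10.1016/j.jde.2020.09.028, 10.1007/s00028-025-01150-1, 1503.05246, 1702.04870, 1803.08401, 1710.10751, 1904.00622, 2112.09955, 1511.03114, doi:10.21136/am.2021.0279-20, doi:10.1016/j.jde.2020.09.028, doi:10.1007/s00028-025-01150-1, arxiv:1702.04870, arxiv:1710.10751, Wiedemann2018, BrezinaFeireisl2018, FeireislLukacovamedvidovaMizerova2018, Rezakhanlou1991, KipnisLandim19]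

Barriers (technique_class: measure-valued weak-strong-uniqueness relative-energy): - technique_class: measure-valued weak-strong-uniqueness relative-energy
- Literature.Barriers.AtomisticToContinuum.WildSolutionsBarrier: evaded — uniqueness is invoked only
against the CLASSICAL solution on [0,T) (BF18 Thm 3.3), never among weak/mv solutions; nothing
post-shock is claimed (its caveat (c)).
- Literature.Barriers.AtomisticToContinuum.ShockFormationBarrier: conceded and inactive —
RelativeEnergyStability presupposes the strong solution exactly as the conjunct does (T = any
classical existence time); no post-shock strengthening.
- Literature.Barriers.AtomisticToContinuum.ShockFormationBarrierNarrow: same — the reference state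
IS the unshifted classical solution; the record blocks only post-shock uses, none here.
- Literature.Barriers.AtomisticToContinuum.HighMomentumCutoffBarrier: evaded — no truncation of
|v|²/2; large velocities enter only L¹(P_N) quantities dominated by the exactly conserved kinetic
energy (D ≡ 0 at finite N).
- Literature.Barriers.AtomisticToContinuum.HighMomentumCutoffBarrierNarrow: evaded at its precise
point — the convective energy current Σχ|v|²v/2 (no exponential moments) never has to be closed:
BF18 uses the TOTAL energy balance only, and K1 is a second-moment statement.
- Literature.Barriers.AtomisticToContinuum.BoltzmannHypothesisBarrier: it does not fully evade it;
the bet is that FluxClosure needs only the WEAK, flux-level identification of the box momentum flux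
(isotropy of second moments, trace fixed by Ê, + virial) and EntropyAd

History (route lifecycle, newest last):
- 2026-08-16T23:25:39Z · rev 6: restated RelativeEnergyStability (stmt-AtomisticToContinuum-9904) — repair step 2/4 (same seat): RelativeEnergyStability restated 1:1 — ONLY change: `0 < T →` inserted after `IsHardSphereEulerSolution σ T ρ u θ →` inside its INL (planner-rrepair-AtomisticToContinuum-BoxDissip-cd2f4aa0-0)
- 2026-08-16T23:28:33Z · rev 7: restated LocalGibbsFineScale (stmt-AtomisticToContinuum-9905) — repair step 3/4 (same seat): LocalGibbsFineScale (K0, support) re-typed 1:1 per its prover's misstatement report (pitem-9905 16:48Z, evidence misstated.md): `0 (planner-rrepair-AtomisticToContinuum-BoxDissip-cd2f4aa0-0)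
- 2026-08-16T23:29:42Z · rev 8: restated Assembly (stmt-AtomisticToContinuum-9907 proved) — repair step 4a/4 (same seat): Assembly re-typed 1:1 to the CURRENT type of `closes` — FluxClosure → EntropyAdmissibility → RelativeEnergyStability → LocalGibbsF (planner-rrepair-AtomisticToContinuum-BoxDissip-cd2f4aa0-0)
- 2026-08-16T23:30:25Z · rev 9: dropped DiluteSelfConsistency — repair step 4b/4 (same seat): DROP DiluteSelfConsistency (shared stmt-3091; support here, crux of route ImplosionLoophole; an open-problem σ-uniform density bou (planner-rrepair-AtomisticToContinuum-BoxDissip-cd2f4aa0-0)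

sub-problem: HydrodynamicLimit · status: open · opened planner-plancard-AtomisticToContinuum-Hydrody-45e5f57a-0 2026-08-15T14:50:38Z · rev 9 · ledger route-AtomisticToContinuum-BoxDissipativeWeakStrong
GENERATED by the gate from the ledger (D-0016/17). Provers cite these decls: `theorem foo : Summit.AtomisticToContinuum.HydrodynamicLimit.Theses.BoxDissipativeWeakStrong.<Decl> := …` in Summits/AtomisticToContinuum/HydrodynamicLimit/Theorems/<Name>.lean.
-/

namespace Summit.AtomisticToContinuum.HydrodynamicLimit.Theses.BoxDissipativeWeakStrong

open scoped BigOperators Topology Manifold Classical MeasureTheory ProbabilityTheory Matrix InnerProductSpace ComplexConjugate ContinuousMap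
open Filter Set Function TopologicalSpace MeasureTheory

attribute [summit_statement] _root_.HydrodynamicLimit

/-- item stmt-AtomisticToContinuum-9902 · crux · rank 2 · open · by planner
why it might fail: Flux-level local equilibrium of DETERMINISTIC spheres at fixed σ: traceless box velocity covariance and collisional virial must relax with no mixing theorem (Spohn1991 §3.3 'beyond scope'; OVY93 need noise; free-gas kernel of BoltzmannHypothesisBarrier breaks exactly this), at EVERY window, L¹(P_N).
sources: Spohn1991, OllaVaradhanYau1993, Literature.Barriers.AtomisticToContinuum.BoltzmannHypothesisBarrierNarrow, NachtergaeleYau2003, BrezinaFeireisl2018, arXiv:2503.01800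
[crux] (card K1) given the hard-sphere EOS fact there is η_c > 0 such that for every band 0 < η₁ <
η_c, all continuous positive profiles, σ < σ₀(profiles), every classical hs-Euler solution on [0,T)
with ρσ³ ≤ η₁/2, every flow family whose local-Gibbs fields satisfy the t = 0 LLN, and EVERY kinetic
window ℓ_N (0 < ℓ_N ≤ 1, ℓ_N → 0, (N+1)ℓ_N³ → ∞): for τ < T and every smooth vector field w on
[0,T)×𝕋³ the pathwise momentum-balance defect of the box fields, [∫m̂·w]_0^τ − ∫_0^τ∫(m̂·∂_t w +
(m̂⊗m̂/ρ̂):∇w + p_cut(ρ̂,θ̂) div w) with θ̂ = ⅔(Ê/ρ̂ − |m̂|²/2ρ̂²) and p_cut = ρ̂θ̂Z(min(ρ̂σ³, η₁)),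
tends to 0 in L¹(P_N). Microscopic content: the traceless box velocity covariance (kinetic stress −
m̂⊗m̂/ρ̂ − ρ̂θ̂𝟙) and (collisional transfer − ρ̂θ̂(Z−1)𝟙) vanish after space-time averaging against
∇w; boxes above the band are flux-negligible. [deps: HsEosLowDensity] [difficulty: open-problem] -/
@[route_item "route-AtomisticToContinuum-BoxDissipativeWeakStrong", crux]
def FluxClosure : Prop :=
  (∃ η₀ : ℝ, 0 < η₀ ∧ ∃ F : ℝ → ℝ, AnalyticOnNhd ℝ F (Ioo (-η₀) η₀) ∧ EqOn Literature.MathematicalPhysics.KineticTheory.hsExcessFreeEnergy F (Ico 0 η₀) ∧ F 0 = 0 ∧ deriv F 0 = 2 * Real.pi / 3 ∧ ∀ η ∈ Ico 0 η₀, Tendsto (fun N : ℕ => -(N : ℝ)⁻¹ * Real.log (Literature.MathematicalPhysics.KineticTheory.hsFreeVolume η N)) atTop (𝓝 (F η))) → ∃ ηc : ℝ, 0 < ηc ∧ ∀ η₁ : ℝ, 0 < η₁ → η₁ < ηc → ∀ (a₀ θ₀ : Literature.MathematicalPhysics.KineticTheory.T3 → ℝ) (u₀ : Literature.MathematicalPhysics.KineticTheory.T3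 → Literature.MathematicalPhysics.KineticTheory.V3), Continuous a₀ → Continuous θ₀ → Continuous u₀ → (∀ x, 0 < a₀ x) → (∀ x, 0 < θ₀ x) → ∃ σ₀ : ℝ, 0 < σ₀ ∧ ∀ σ : ℝ, 0 < σ → σ < σ₀ → ∀ (T : ℝ) (ρ θ : ℝ → Literature.MathematicalPhysics.KineticTheory.T3 → ℝ) (u : ℝ → Literature.MathematicalPhysics.KineticTheory.T3 → Literature.MathematicalPhysics.KineticTheory.V3), Literature.MathematicalPhysics.KineticTheory.IsHardSphereEulerSolution σ T ρ u θ → (∀ t ∈ Ico 0 T, ∀ x, ρ t x * σ ^ 3 ≤ η₁ / 2) → ∀ Φ : (N : ℕ) → Literature.Analysis.FluidPDE.HardSphereFlow (Literature.Analysis.FluidPDE.Torus.geometry (Fin 3)) (Literature.MathematicalPhysics.KineticTheory.hsDiameter σ N) (N + 1), Literature.MathematicalPhysics.KineticTheory.TendstoHydroFieldsAt (fun N => Literature.MathematicalPhysics.KineticTheory.localGibbsLaw σ a₀ u₀ θ₀ N (Φ N)) Φ ρ u θ 0 → ∀ ℓ : ℕ → ℝ, (∀ N, 0 < ℓ N ∧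 ℓ N ≤ 1) → Tendsto ℓ atTop (𝓝 0) → Tendsto (fun N : ℕ => ℓ N ^ 3 * ((N : ℝ) + 1)) atTop atTop → let K := fun (l : ℝ) (x y : Literature.MathematicalPhysics.KineticTheory.T3) => indicator {y' : Literature.MathematicalPhysics.KineticTheory.T3 | ∀ i, ‖y' i - x i‖ < l / 2} (fun _ => (l ^ 3)⁻¹) y; let Dn := fun N t z x => Literature.MathematicalPhysics.KineticTheory.empiricalDensityField ((Φ N).flow t z) (K (ℓ N) x); let Mm := fun N t z x => Literature.MathematicalPhysics.KineticTheory.empiricalMomentumField ((Φ N).flow t z) (K (ℓ N) x); let En := fun N t z x => Literature.MathematicalPhysics.KineticTheory.empiricalEnergyField ((Φ N).flow t z) (K (ℓ N) x); let Th := fun (r : ℝ) (m : Literature.MathematicalPhysics.KineticTheory.V3) (E : ℝ) => 2 / 3 * (E / r - ‖m‖ ^ 2 / (2 * r ^ 2)); let Zc := fun η : ℝ => Literature.MathematicalPhysics.KineticTheory.hsCompressibility (min η η₁); let Pc := fun r ϑ : ℝ => r * ϑ * Zc (r * σ ^ 3); ∀ τ ∈ Ico 0 T, ∀ w : ℝ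 → Literature.MathematicalPhysics.KineticTheory.T3 → Literature.MathematicalPhysics.KineticTheory.V3, Literature.Analysis.FunctionSpaces.Torus.IsSmoothSpaceTimeOn (Ico 0 T) w → Tendsto (fun N : ℕ => ∫⁻ z, ENNReal.ofReal (|(∫ x, inner ℝ (Mm N τ z x) (w τ x)) - (∫ x, inner ℝ (Mm N 0 z x) (w 0 x)) - ∫ t in Ioc 0 τ, ∫ x, (inner ℝ (Mm N t z x) (Literature.Analysis.FunctionSpaces.Torus.timeDerivWithin (Ico 0 T) w t x) + (∑ i, ∑ j, Mm N t z x i * Mm N t z x j / Dn N t z x * Literature.Analysis.FunctionSpaces.Torus.partialDeriv j (fun y => w t y i) x) + Pc (Dn N t z x) (Th (Dn N t z x) (Mm N t z x) (En N t z x)) * Literature.Analysis.FunctionSpaces.Torus.divergence (w t) x)|) ∂(Literature.MathematicalPhysics.KineticTheory.localGibbsLaw σ a₀ u₀ θ₀ N (Φ N))) atTop (𝓝 0)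

/-- item stmt-AtomisticToContinuum-9903 · crux · rank 3 · open · by planner
why it might fail: No H-theorem for a deterministic interacting gas: a LOCAL clamped second law in expectation needs entropy flux = Z(s)m̂ (no Euler-order heat current) and, ρs being concave in (ρ,m,E), positive-time concentration of box fields at kinetic windows — a hidden weak local-equilibrium statement.
sources: BrezinaFeireisl2018, BrezinaFeireisl2018Revisited, ChenFrid2000, Spohn1991, OllaVaradhanYau1993, KipnisLandim1999
[crux] (card K2) same frame as FluxClosure; for τ < T, reals a < b and every smooth φ ≥ 0 on
[0,τ]×𝕋³ the positive part of ∫_0^τ∫(ρ̂Z_{a,b}(ŝ)∂_tφ + Z_{a,b}(ŝ)m̂·∇φ) − [∫ρ̂Z_{a,b}(ŝ)φ]_0^τ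
tends to 0 in L¹(P_N), where ŝ = 3/2 log θ̂ − log ρ̂ − F_cut(ρ̂σ³) is the box entropy with the
Gibbs-consistent cut excess free energy F_cut(η) = f_ex(min η η₁) + (Z(η₁)−1)log(max η η₁/η₁) and
Z_{a,b}(s) = max a (min s b): BF18's renormalised entropy inequality (Def. 2.9, Z ∈ BC(ℝ), Z′ ≥ 0;
clamps as in §3.2) for the law of the box state, in expectation, zero defect. [deps:
HsEosLowDensity] [difficulty: open-problem] -/
@[route_item "route-AtomisticToContinuum-BoxDissipativeWeakStrong", crux]
def EntropyAdmissibility : Prop :=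
  (∃ η₀ : ℝ, 0 < η₀ ∧ ∃ F : ℝ → ℝ, AnalyticOnNhd ℝ F (Ioo (-η₀) η₀) ∧ EqOn Literature.MathematicalPhysics.KineticTheory.hsExcessFreeEnergy F (Ico 0 η₀) ∧ F 0 = 0 ∧ deriv F 0 = 2 * Real.pi / 3 ∧ ∀ η ∈ Ico 0 η₀, Tendsto (fun N : ℕ => -(N : ℝ)⁻¹ * Real.log (Literature.MathematicalPhysics.KineticTheory.hsFreeVolume η N)) atTop (𝓝 (F η))) → ∃ ηc : ℝ, 0 < ηc ∧ ∀ η₁ : ℝ, 0 < η₁ → η₁ < ηc → ∀ (a₀ θ₀ : Literature.MathematicalPhysics.KineticTheory.T3 → ℝ) (u₀ : Literature.MathematicalPhysics.KineticTheory.T3 → Literature.MathematicalPhysics.KineticTheory.V3), Continuous a₀ → Continuous θ₀ → Continuous u₀ → (∀ x, 0 < a₀ x) → (∀ x, 0 < θ₀ x) → ∃ σ₀ : ℝ, 0 < σ₀ ∧ ∀ σ : ℝ, 0 < σ → σ < σ₀ → ∀ (T : ℝ) (ρ θ : ℝ → Literature.MathematicalPhysics.KineticTheory.T3 → ℝ)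 (u : ℝ → Literature.MathematicalPhysics.KineticTheory.T3 → Literature.MathematicalPhysics.KineticTheory.V3), Literature.MathematicalPhysics.KineticTheory.IsHardSphereEulerSolution σ T ρ u θ → (∀ t ∈ Ico 0 T, ∀ x, ρ t x * σ ^ 3 ≤ η₁ / 2) → ∀ Φ : (N : ℕ) → Literature.Analysis.FluidPDE.HardSphereFlow (Literature.Analysis.FluidPDE.Torus.geometry (Fin 3)) (Literature.MathematicalPhysics.KineticTheory.hsDiameter σ N) (N + 1), Literature.MathematicalPhysics.KineticTheory.TendstoHydroFieldsAt (fun N => Literature.MathematicalPhysics.KineticTheory.localGibbsLaw σ a₀ u₀ θ₀ N (Φ N)) Φ ρ u θ 0 → ∀ ℓ : ℕ → ℝ, (∀ N, 0 < ℓ N ∧ ℓ N ≤ 1) → Tendsto ℓ atTop (𝓝 0) → Tendsto (fun N : ℕ => ℓ N ^ 3 * ((N : ℝ) + 1)) atTop atTop → let K := fun (l : ℝ) (x y : Literature.MathematicalPhysics.KineticTheory.T3) => indicator {y' : Literature.MathematicalPhysics.KineticTheory.T3 | ∀ i, ‖y' i - x i‖ < l / 2} (fun _ => (l ^ 3)⁻¹)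 y; let Dn := fun N t z x => Literature.MathematicalPhysics.KineticTheory.empiricalDensityField ((Φ N).flow t z) (K (ℓ N) x); let Mm := fun N t z x => Literature.MathematicalPhysics.KineticTheory.empiricalMomentumField ((Φ N).flow t z) (K (ℓ N) x); let En := fun N t z x => Literature.MathematicalPhysics.KineticTheory.empiricalEnergyField ((Φ N).flow t z) (K (ℓ N) x); let Th := fun (r : ℝ) (m : Literature.MathematicalPhysics.KineticTheory.V3) (E : ℝ) => 2 / 3 * (E / r - ‖m‖ ^ 2 / (2 * r ^ 2)); let Fc := fun η : ℝ => Literature.MathematicalPhysics.KineticTheory.hsExcessFreeEnergy (min η η₁) + (Literature.MathematicalPhysics.KineticTheory.hsCompressibility η₁ - 1) * Real.log (max η η₁ / η₁); let Sc := fun r ϑ : ℝ => 3 / 2 * Real.log ϑ - Real.log r - Fc (r * σ ^ 3); ∀ τ ∈ Ico 0 T, ∀ a b : ℝ, a < b → ∀ φ : ℝ → Literature.MathematicalPhysics.KineticTheory.T3 → ℝ, Literature.Analysis.FunctionSpaces.Torus.IsSmoothSpaceTimeOn (Ico 0 T) φ → (∀ t ∈ Icc 0 τ, ∀ x, 0 ≤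 φ t x) → Tendsto (fun N : ℕ => ∫⁻ z, ENNReal.ofReal ((∫ t in Ioc 0 τ, ∫ x, (Dn N t z x * max a (min (Sc (Dn N t z x) (Th (Dn N t z x) (Mm N t z x) (En N t z x))) b) * Literature.Analysis.FunctionSpaces.Torus.timeDerivWithin (Ico 0 T) φ t x + max a (min (Sc (Dn N t z x) (Th (Dn N t z x) (Mm N t z x) (En N t z x))) b) * inner ℝ (Mm N t z x) (Literature.Analysis.FunctionSpaces.Torus.gradient (φ t) x))) - (∫ x, Dn N τ z x * max a (min (Sc (Dn N τ z x) (Th (Dn N τ z x) (Mm N τ z x) (En N τ z x))) b) * φ τ x) + (∫ x, Dn N 0 z x * max a (min (Sc (Dn N 0 z x) (Th (Dn N 0 z x) (Mm N 0 z x) (En N 0 z x))) b) * φ 0 x)) ∂(Literature.MathematicalPhysics.KineticTheory.localGibbsLaw σ a₀ u₀ θ₀ N (Φ N))) atTop (𝓝 0)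

-- earlier RelativeEnergyStability (stmt-AtomisticToContinuum-9904, replaced 2026-08-16T23:25:39Z -> stmt-AtomisticToContinuum-17653): retired by None — FluxClosure → EntropyAdmissibility → (∀ (a₀ θ₀ : Literature.MathematicalPhysics.KineticTheory.T3 → ℝ) (u₀ : Literature.MathematicalPhysics.KineticTheory.T3 → Literature.MathematicalPhysics.KineticTheory.V3), Continuous a₀ → Continuous θ₀ → Continuous
/-- item stmt-AtomisticToContinuum-17653 · crux · rank 4 · closed · proved by Summit.AtomisticToContinuum.HydrodynamicLimit.Theorems.RelativeEnergyStability_proof @ f3fed154a8a6 (prover) · by planner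
why it might fail: BF18 Thm 3.3/§3.2.1 assume Dirac data and un-clamp E_Z by the a.s. entropy minimum principle before coercivity (WS8); FLMW Thm 7.1 needs ρ_h ≥ ρ_min, E_h ≤ Ē. Finite-N box laws charge vacuum/cold boxes and only bounded clamps are hypothesised: coercivity of E_{Z_{a,b}} for the cut EOS is unprinted.
sources: BrezinaFeireisl2018, BrezinaFeireisl2018Revisited, FeireislLukacovamedvidovaMizerova2018, FeireislNovotny2012, Dafermos1979, Wiedemann2018
[crux] (card K3, the PDE theorem in expectation at finite N, stated as the implication between the
route's closure statements and the packing-guarded conjunct) FluxClosure → EntropyAdmissibility →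
LocalGibbsFineScale (inlined verbatim, AS RE-TYPED with `0 < T`) → [given the EOS fact (inlined), ∃
η_c > 0 ∀ η₁ < η_c ∀ profiles ∃ σ₀ ∀ σ < σ₀ ∀ classical hs-Euler solutions on [0,T) with ρσ³ ≤ η₁/2
∀ flow families with the t = 0 LLN: the empirical fields converge in probability to (ρ, ρu, E)(t) at
every t < T] — 2026-08-16 repair: the inlined K0 antecedent carries the same `0 < T →` insertion as
the re-typed item LocalGibbsFineScale (prover's misstatement report on stmt-9905; K3 only ever
instantiates K0 at the T > 0 of a non-empty [0,T), so its provability is unchanged). Intended proof,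
per instance and at any one kinetic window: BF18 Thm 3.3 on e_N(τ) = E_P∫E(Û_N(τ,x) | ρ,θ,u(τ,x))dx
with Young measure := law of the box state and D ≡ 0 (pathwise continuity equation and energy
conservation from the HardSphereFlow axioms), cut EOS (Gibbs relation, ∂_ρp_cut > 0, c_v = 3/2,
|p_cut| ≤ Z(η₁)ρθ so BF18's growth hypothesis holds), essential/residual coercivity, minimum
principle from φ = 1 re -/
@[route_item "route-AtomisticToContinuum-BoxDissipativeWeakStrong", crux]
def RelativeEnergyStability : Prop :=
  FluxClosure → EntropyAdmissibility → (∀ (a₀ θ₀ : Literature.MathematicalPhysics.KineticTheory.T3 → ℝ) (u₀ : Literature.MathematicalPhysics.KineticTheory.T3 → Literature.MathematicalPhysics.KineticTheory.V3), Continuous a₀ → Continuous θ₀ → Continuous u₀ → (∀ x, 0 < a₀ x) → (∀ x, 0 < θ₀ x) → ∃ σ₀ : ℝ, 0 < σ₀ ∧ ∀ σ : ℝ, 0 < σ → σ < σ₀ → ∀ (T : ℝ) (ρ θ : ℝ → Literature.MathematicalPhysics.KineticTheory.T3 → ℝ) (u : ℝ → Literature.MathematicalPhysics.KineticTheory.T3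 → Literature.MathematicalPhysics.KineticTheory.V3), Literature.MathematicalPhysics.KineticTheory.IsHardSphereEulerSolution σ T ρ u θ → 0 < T → ∀ Φ : (N : ℕ) → Literature.Analysis.FluidPDE.HardSphereFlow (Literature.Analysis.FluidPDE.Torus.geometry (Fin 3)) (Literature.MathematicalPhysics.KineticTheory.hsDiameter σ N) (N + 1), Literature.MathematicalPhysics.KineticTheory.TendstoHydroFieldsAt (fun N => Literature.MathematicalPhysics.KineticTheory.localGibbsLaw σ a₀ u₀ θ₀ N (Φ N)) Φ ρ u θ 0 → ∀ ℓ : ℕ → ℝ, (∀ N, 0 < ℓ N ∧ ℓ N ≤ 1) → Tendsto ℓ atTop (𝓝 0) → Tendsto (fun N : ℕ => ℓ N ^ 3 * ((N : ℝ) + 1)) atTop atTop → let K := fun (l : ℝ) (x y : Literature.MathematicalPhysics.KineticTheory.T3) => indicator {y' : Literature.MathematicalPhysics.KineticTheory.T3 | ∀ i, ‖y' i - x i‖ < l / 2} (fun _ => (l ^ 3)⁻¹) y; let Dn := fun N t z x => Literature.MathematicalPhysics.KineticTheory.empiricalDensityField ((Φ N).flow t z) (K (ℓ N) x); let Mm :=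 fun N t z x => Literature.MathematicalPhysics.KineticTheory.empiricalMomentumField ((Φ N).flow t z) (K (ℓ N) x); let En := fun N t z x => Literature.MathematicalPhysics.KineticTheory.empiricalEnergyField ((Φ N).flow t z) (K (ℓ N) x); Tendsto (fun N : ℕ => ∫⁻ z, ENNReal.ofReal (∫ x, (|Dn N 0 z x - ρ 0 x| + ‖Mm N 0 z x - ρ 0 x • u 0 x‖ + |En N 0 z x - Literature.MathematicalPhysics.KineticTheory.totalEnergyDensity (ρ 0 x) (u 0 x) (θ 0 x)|)) ∂(Literature.MathematicalPhysics.KineticTheory.localGibbsLaw σ a₀ u₀ θ₀ N (Φ N))) atTop (𝓝 0)) → (∃ η₀ : ℝ, 0 < η₀ ∧ ∃ F : ℝ → ℝ, AnalyticOnNhd ℝ F (Ioo (-η₀) η₀) ∧ EqOn Literature.MathematicalPhysics.KineticTheory.hsExcessFreeEnergy F (Ico 0 η₀) ∧ F 0 = 0 ∧ deriv F 0 = 2 * Real.pi / 3 ∧ ∀ η ∈ Ico 0 η₀, Tendsto (fun N : ℕ => -(N : ℝ)⁻¹ * Real.log (Literature.MathematicalPhysics.KineticTheory.hsFreeVolume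 η N)) atTop (𝓝 (F η))) → ∃ ηc : ℝ, 0 < ηc ∧ ∀ η₁ : ℝ, 0 < η₁ → η₁ < ηc → ∀ (a₀ θ₀ : Literature.MathematicalPhysics.KineticTheory.T3 → ℝ) (u₀ : Literature.MathematicalPhysics.KineticTheory.T3 → Literature.MathematicalPhysics.KineticTheory.V3), Continuous a₀ → Continuous θ₀ → Continuous u₀ → (∀ x, 0 < a₀ x) → (∀ x, 0 < θ₀ x) → ∃ σ₀ : ℝ, 0 < σ₀ ∧ ∀ σ : ℝ, 0 < σ → σ < σ₀ → ∀ (T : ℝ) (ρ θ : ℝ → Literature.MathematicalPhysics.KineticTheory.T3 → ℝ) (u : ℝ → Literature.MathematicalPhysics.KineticTheory.T3 → Literature.MathematicalPhysics.KineticTheory.V3), Literature.MathematicalPhysics.KineticTheory.IsHardSphereEulerSolution σ T ρ u θ → (∀ t ∈ Ico 0 T, ∀ x, ρ t x * σ ^ 3 ≤ η₁ / 2) → ∀ Φ : (N : ℕ) → Literature.Analysis.FluidPDE.HardSphereFlow (Literature.Analysis.FluidPDE.Torus.geometry (Fin 3)) (Literature.MathematicalPhysics.KineticTheory.hsDiameter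 σ N) (N + 1), Literature.MathematicalPhysics.KineticTheory.TendstoHydroFieldsAt (fun N => Literature.MathematicalPhysics.KineticTheory.localGibbsLaw σ a₀ u₀ θ₀ N (Φ N)) Φ ρ u θ 0 → ∀ t ∈ Ico 0 T, Literature.MathematicalPhysics.KineticTheory.TendstoHydroFieldsAt (fun N => Literature.MathematicalPhysics.KineticTheory.localGibbsLaw σ a₀ u₀ θ₀ N (Φ N)) Φ ρ u θ t

/-- item stmt-AtomisticToContinuum-0768 · support · rank 9 · closed · proved by Summit.AtomisticToContinuum.HydrodynamicLimit.Theorems.hsEosLowDensity_proof (prover) · by planner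
sources: Ruelle1969, LebowitzPenrose1964
[support] Hard-sphere equation of state at low density: ∃ η₀ > 0 and F real-analytic on (−η₀, η₀)
with hsExcessFreeEnergy = F on [0, η₀), F(0) = 0, F'(0) = 2π/3 (second virial coefficient of
unit-diameter spheres), and the canonical thermodynamic limit −N⁻¹ log hsFreeVolume η N → F(η)
exists (not just limsup) for η ∈ [0, η₀). Ruelle1969 §3.4 (existence), LebowitzPenrose1964
(convergence of the virial expansion ⇒ analyticity). Makes hsCompressibility/hsPressure smooth and
Z(η) = 1 + (2π/3)η + O(η²); needed by every route (hyperbolicity of the Euler system, virial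
theorem). -/
@[route_item "route-AtomisticToContinuum-BoxDissipativeWeakStrong", crux]
def HsEosLowDensity : Prop :=
  ∃ η₀ : ℝ, 0 < η₀ ∧ ∃ F : ℝ → ℝ, AnalyticOnNhd ℝ F (Set.Ioo (-η₀) η₀) ∧ Set.EqOn Literature.MathematicalPhysics.KineticTheory.hsExcessFreeEnergy F (Set.Ico 0 η₀) ∧ F 0 = 0 ∧ deriv F 0 = 2 * Real.pi / 3 ∧ ∀ η ∈ Set.Ico 0 η₀, Filter.Tendsto (fun N : ℕ => -(N : ℝ)⁻¹ * Real.log (Literature.MathematicalPhysics.KineticTheory.hsFreeVolume η N)) Filter.atTop (nhds (F η))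

/-- `HsEosLowDensity` holds: proved by `Summit.AtomisticToContinuum.HydrodynamicLimit.Theorems.hsEosLowDensity_proof`. -/
theorem HsEosLowDensity_holds : HsEosLowDensity := _root_.Summit.AtomisticToContinuum.HydrodynamicLimit.Theorems.hsEosLowDensity_proof

-- earlier LocalGibbsFineScale (stmt-AtomisticToContinuum-9905, replaced 2026-08-16T23:28:33Z -> stmt-AtomisticToContinuum-17712): retired by None — ∀ (a₀ θ₀ : Literature.MathematicalPhysics.KineticTheory.T3 → ℝ) (u₀ : Literature.MathematicalPhysics.KineticTheory.T3 → Literature.MathematicalPhysics.KineticTheory.V3), Continuous a₀ → Continuous θ₀ → Continuous u₀ → (∀ x, 0 < a₀ x) → (∀ x, 0 < θ₀ x) → 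
/-- item stmt-AtomisticToContinuum-17712 · support · rank 9 · closed · proved by Summit.AtomisticToContinuum.HydrodynamicLimit.Theorems.localGibbsFineScale_proof @ 9f38bbb3c448 (prover) · by planner
sources: Ruelle1969, LebowitzPenrose1964, Spohn1991
[support] (card P1 = K0, statics; RE-TYPED 2026-08-16 with `0 < T →` inserted after
`IsHardSphereEulerSolution σ T ρ u θ →` on the prover's misstatement report (pitem-9905, evidence
misstated.md): for T ≤ 0 the solution predicate is vacuous (Ico 0 T = ∅), so ρ 0, u 0, θ 0 are
arbitrary — possibly non-measurable — functions pinned only through junk-valued Bochner integrals, a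
corner unrelated to K0; the route's `closes` and RelativeEnergyStability instantiate K0 only at the
T > 0 of a non-empty [0,T)) for continuous positive profiles, σ < σ₀, every classical solution on
[0,T) with 0 < T whose t = 0 fields are the macroscopic LLN limit of the local Gibbs laws and every
kinetic window: E_P∫(|ρ̂ − ρ(0,·)| + ‖m̂ − ρu(0,·)‖ + |Ê − E(0,·)|)(x)dx → 0 at t = 0 — low-activity
cluster expansion (correlation length ≍ particle scale (N+1)^(−1/3) ≪ ℓ_N) plus Gaussian velocities;
the macroscopic hypothesis identifies the continuous limit profiles. PROVED as re-typed:
Summit.AtomisticToContinuum.HydrodynamicLimit.Theorems.LGFS.localGibbsFineScale_of_pos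
(Theorems/BoxDissipativeWeakStrongLocalGibbsFineScalePos.lean, p115466; statement byte-identical) —
closing file is one line. [difficulty: M] [Rue -/
@[route_item "route-AtomisticToContinuum-BoxDissipativeWeakStrong", crux]
def LocalGibbsFineScale : Prop :=
  ∀ (a₀ θ₀ : Literature.MathematicalPhysics.KineticTheory.T3 → ℝ) (u₀ : Literature.MathematicalPhysics.KineticTheory.T3 → Literature.MathematicalPhysics.KineticTheory.V3), Continuous a₀ → Continuous θ₀ → Continuous u₀ → (∀ x, 0 < a₀ x) → (∀ x, 0 < θ₀ x) → ∃ σ₀ : ℝ, 0 < σ₀ ∧ ∀ σ : ℝ, 0 < σ → σ < σ₀ → ∀ (T : ℝ) (ρ θ : ℝ → Literature.MathematicalPhysics.KineticTheory.T3 → ℝ) (u : ℝ → Literature.MathematicalPhysics.KineticTheory.T3 → Literature.MathematicalPhysics.KineticTheory.V3), Literature.MathematicalPhysics.KineticTheory.IsHardSphereEulerSolution σ T ρ u θ → 0 < T → ∀ Φ : (N : ℕ) → Literature.Analysis.FluidPDE.HardSphereFlow (Literature.Analysis.FluidPDE.Torus.geometry (Fin 3)) (Literature.MathematicalPhysics.KineticTheory.hsDiameter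 σ N) (N + 1), Literature.MathematicalPhysics.KineticTheory.TendstoHydroFieldsAt (fun N => Literature.MathematicalPhysics.KineticTheory.localGibbsLaw σ a₀ u₀ θ₀ N (Φ N)) Φ ρ u θ 0 → ∀ ℓ : ℕ → ℝ, (∀ N, 0 < ℓ N ∧ ℓ N ≤ 1) → Tendsto ℓ atTop (𝓝 0) → Tendsto (fun N : ℕ => ℓ N ^ 3 * ((N : ℝ) + 1)) atTop atTop → let K := fun (l : ℝ) (x y : Literature.MathematicalPhysics.KineticTheory.T3) => indicator {y' : Literature.MathematicalPhysics.KineticTheory.T3 | ∀ i, ‖y' i - x i‖ < l / 2} (fun _ => (l ^ 3)⁻¹) y; let Dn := fun N t z x => Literature.MathematicalPhysics.KineticTheory.empiricalDensityField ((Φ N).flow t z) (K (ℓ N) x); let Mm := fun N t z x => Literature.MathematicalPhysics.KineticTheory.empiricalMomentumField ((Φ N).flow t z) (K (ℓ N) x); let En := fun N t z x => Literature.MathematicalPhysics.KineticTheory.empiricalEnergyField ((Φ N).flow t z) (K (ℓ N) x); Tendsto (fun N : ℕ => ∫⁻ z, ENNReal.ofReal (∫ x, (|Dn N 0 z x - ρ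 0 x| + ‖Mm N 0 z x - ρ 0 x • u 0 x‖ + |En N 0 z x - Literature.MathematicalPhysics.KineticTheory.totalEnergyDensity (ρ 0 x) (u 0 x) (θ 0 x)|)) ∂(Literature.MathematicalPhysics.KineticTheory.localGibbsLaw σ a₀ u₀ θ₀ N (Φ N))) atTop (𝓝 0)

/-- item stmt-AtomisticToContinuum-9906 · support · rank 9 · closed · proved by Summit.AtomisticToContinuum.HydrodynamicLimit.Theorems.hsEntropyConvex_proof' @ 0cd248dbd2fe (prover) · by planner
sources: Dafermos1979, BrezinaFeireisl2018, Ruelle1969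
[support] (ex stmt-AtomisticToContinuum-0817 verbatim; BF18's thermodynamic-stability hypothesis
(WS1) in conserved variables, lemma for RelativeEnergyStability) given the EOS fact, ∃ η₀ > 0 ∀ σ >
0: U = (ρ, m, E) ↦ −ρ(3/2 log θ(U) − log ρ − f_ex(ρσ³)) is strictly convex on the convex set {ρ > 0,
ρσ³ < η₀, |m|² < 2ρE} ((ηZ)′ > 0 near 0 + perspective argument). [difficulty: M] -/
@[route_item "route-AtomisticToContinuum-BoxDissipativeWeakStrong"]
def HsEntropyConvex : Prop :=
  (∃ η₀ : ℝ, 0 < η₀ ∧ ∃ F : ℝ → ℝ, AnalyticOnNhd ℝ F (Set.Ioo (-η₀) η₀) ∧ Set.EqOn Literature.MathematicalPhysics.KineticTheory.hsExcessFreeEnergy F (Set.Ico 0 η₀) ∧ F 0 = 0 ∧ deriv F 0 = 2 * Real.pi / 3 ∧ ∀ η ∈ Set.Ico 0 η₀, Filter.Tendsto (fun N : ℕ => -(N : ℝ)⁻¹ * Real.log (Literature.MathematicalPhysics.KineticTheory.hsFreeVolume η N)) Filter.atTop (nhds (F η))) → ∃ η₀ : ℝ, 0 < η₀ ∧ ∀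 σ : ℝ, 0 < σ → StrictConvexOn ℝ {U : ℝ × Literature.MathematicalPhysics.KineticTheory.V3 × ℝ | 0 < U.1 ∧ U.1 * σ ^ 3 < η₀ ∧ ‖U.2.1‖ ^ 2 < 2 * U.1 * U.2.2} (fun U : ℝ × Literature.MathematicalPhysics.KineticTheory.V3 × ℝ => -(U.1 * (3 / 2 * Real.log (2 / 3 * (U.2.2 / U.1 - ‖U.2.1‖ ^ 2 / (2 * U.1 ^ 2))) - Real.log U.1 - Literature.MathematicalPhysics.KineticTheory.hsExcessFreeEnergy (U.1 * σ ^ 3))))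

-- earlier Assembly (stmt-AtomisticToContinuum-9907, replaced 2026-08-16T23:29:42Z -> stmt-AtomisticToContinuum-17724): proved by Summit.AtomisticToContinuum.HydrodynamicLimit.Theorems.boxDissipativeWeakStrong_assembly_proof @ 34674fe2c779 — FluxClosure → EntropyAdmissibility → RelativeEnergyStability → LocalGibbsFineScale → HsEosLowDensity → DiluteSelfConsistency → HydrodynamicLimit
/-- item stmt-AtomisticToContinuum-17724 · assembly · rank 1 · closed · proved by Summit.AtomisticToContinuum.HydrodynamicLimit.Theorems.boxDissipativeWeakStrong_assembly_proof @ b3b094988718 (prover) · by planner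
sources: BrezinaFeireisl2018, Spohn1991, OllaVaradhanYau1993
[assembly] FluxClosure → EntropyAdmissibility → RelativeEnergyStability → LocalGibbsFineScale →
HsEosLowDensity → HydrodynamicLimit — identical to the type of the deciding theorem `closes` after
the 2026-08-16 repair (statement re-type p126922: the conjunct is packing-guarded, so
DiluteSelfConsistency left the chain; LocalGibbsFineScale as re-typed with `0 < T`). Provable at
once: `fun h1 h2 h3 h0 hE => closes h1 h2 h3 h0 hE` in a Theorems file importing the route file.
(Formerly stmt-9907 with `… → DiluteSelfConsistency → HydrodynamicLimit`, proved against the old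
unguarded abbrev; that proof module Theorems/BoxDissipativeWeakStrongAssembly.lean no longer
compiles after the re-type.) -/
@[route_item "route-AtomisticToContinuum-BoxDissipativeWeakStrong"]
def Assembly : Prop :=
  FluxClosure → EntropyAdmissibility → RelativeEnergyStability → LocalGibbsFineScale → HsEosLowDensity → HydrodynamicLimit

/-! D-0027 §2.1 — DECIDING THEOREM (planner-authored via `route open/edit --closes-file`; by planner-rrepair-AtomisticToContinuum-BoxDissip-cd2f4aa0-0 2026-08-16T23:28:33Z):
its hypotheses are this route's items and its conclusion the sub-problem Statement (glue_lint), and it elaborates with this file. -/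

/-- D-0027 §2.1 deciding theorem (route BoxDissipativeWeakStrong, card dissipative-box-closure-bf18;
rev 5 = statement re-type p126922, 2026-08-16): pure quantifier bookkeeping —
`RelativeEnergyStability` fed with `FluxClosure`, `EntropyAdmissibility`, `LocalGibbsFineScale`
and `HsEosLowDensity` gives a threshold `η_c > 0` and the packing-guarded limit on every band
`η₁ < η_c` (guard `ρ σ³ ≤ η₁/2`). The re-typed sub-problem decl `HydrodynamicLimit` IS a
packing-guarded limit with its threshold `∃ η₀ > 0` outermost, so take `η₀ := η_c/4` and the band
`η₁ := η_c/2`: the Statement's own guard `ρ_t(x) σ³ < η_c/4` yields `ρ_t(x) σ³ ≤ η₁/2`, the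
guarded limit's `σ₀(profiles)` is used as is, and it returns `TendstoHydroFieldsAt` at every
`t < T`. `DiluteSelfConsistency` (which discharged the band against the old UNGUARDED abbrev,
rev 1–4) is no longer a hypothesis: the route decides the conjunct from K1–K3 + K0 + the EOS fact. -/
@[closes "route-AtomisticToContinuum-BoxDissipativeWeakStrong"] theorem closes (h1 : FluxClosure) (h2 : EntropyAdmissibility) (h3 : RelativeEnergyStability)
    (h0 : LocalGibbsFineScale) (hE : HsEosLowDensity) : HydrodynamicLimit := by
  obtain ⟨ηc, hηc, H⟩ := h3 h1 h2 h0 hE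
  refine ⟨ηc / 2 / 2, half_pos (half_pos hηc), ?_⟩
  intro a₀ θ₀ u₀ ha hθ hu ha0 hθ0
  obtain ⟨σ₁, hσ₁, G⟩ := H (ηc / 2) (half_pos hηc) (half_lt_self hηc) a₀ θ₀ u₀ ha hθ hu ha0 hθ0
  refine ⟨σ₁, hσ₁, ?_⟩
  intro σ hσ hσlt T ρ θ u hEul hG Φ hL0 t ht
  exact G σ hσ hσlt T ρ θ u hEul (fun s hs x => le_of_lt (hG s hs x)) Φ hL0 t ht

end Summit.AtomisticToContinuum.HydrodynamicLimit.Theses.BoxDissipativeWeakStrong
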